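import Summits.NavierStokesRegularity.TurbBounds.ShearSpecQFormsTF
import Summits.NavierStokesRegularity.TurbBounds.ShearSpecLadder
import Summits.NavierStokesRegularity.TurbBounds.ShearBridgeNorms
import HarnessLib

/-!
# Two-field bridge, norm part: `16·KINV2∫W_xx² + 8∫W_x² + K2∫W² = cᵀXWc + tails`, `4∫Θ_x² + K2∫Θ² = dᵀXTd + tails` (rbsdp SPEC 3.5)

Cell `turb-bounds` (pub-turb), shear lane, pub-turb-shear gen 6 (2026-08-22); v2 lane. The Couette (and RB two-field) analogue of `ShearBridgeNorms`:
the ladder dictionary for the two-field tables (`lin tfD1 c = a`, `lin tfD0 c = b`, `lin tfDT d = e` from `IsLadder` + wall relations) and the exact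
Parseval splits for real polynomials `W` (with `W(−1) = W_x(−1) = 0`) and `Θ` (with `Θ(−1) = 0`) — theorems `normsW_split`, `normsT_split`.
On the tree's `LegendreCoeffs`. HONEST FRAMING: rigorous bounds for the stated PDE and boundary conditions; no claim about physical turbulence beyond the bound.
-/

set_option linter.style.longLine false

noncomputable section

namespace Summit.NavierStokesRegularity.TurbBounds.ShearSpecPiecesTF

open Finset Polynomial intervalIntegral Summit.NavierStokesRegularity.TurbBounds.ShearSpecPieces
open Summit.NavierStokesRegularity.TurbBounds.LadderTail (w IsLadder)
open Summit.NavierStokesRegularity.TurbBounds.LegendreCoeffs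

/-! ### ladder dictionary for the two-field tables -/

/-- `tfD1` rows written out (`n < N+P+2`; all touched columns `< N+P+3`). -/
theorem lin_tfD1 (N P n : ℕ) (hn : n < N + P + 2) (x : ℕ → ℝ) :
    lin (tfD1 N P) (N + P + 3) n x
      = if n = 0 then x 0 - x 1 / 3 else x (n - 1) / (2 * (n : ℝ) - 1) - x (n + 1) / (2 * (n : ℝ) + 3) := by
  unfold lin
  have hent : ∀ j < N + P + 3, (get2 (tfD1 N P) n j : ℝ) = ((intEntry n j : ℚ) : ℝ) := by
    intro j hj; rw [get2_tfD1, if_pos ⟨hn, hj⟩]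
  by_cases h0 : n = 0
  · subst h0
    rw [if_pos rfl, sum_two_points _ 0 1 (by omega) (by omega) (by omega)]
    · rw [hent 0 (by omega), hent 1 (by omega)]; unfold intEntry; push_cast; simp; ring
    · intro j hj h1 h2; rw [hent j hj]; unfold intEntry; simp [h1, h2]
  · rw [if_neg h0, sum_two_points _ (n - 1) (n + 1) (by omega) (by omega) (by omega)]
    · rw [hent (n - 1) (by omega), hent (n + 1) (by omega)]; unfold intEntry
      have e1 : n - 1 + 1 = n := by omega
      have e2 : ¬ n - 1 = n + 1 := by omega
      have e3 : ¬ (n + 1) + 1 = n := by omega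
      simp only [h0, e1, e2, e3, if_true, if_false]
      push_cast; ring
    · intro j hj h1 h2; rw [hent j hj]; unfold intEntry
      have e2 : ¬ j + 1 = n := by omega
      simp [h0, e2, h2]

/-- `tfDT` rows written out (`n < N+P+1`). -/
theorem lin_tfDT (N P n : ℕ) (hn : n < N + P + 1) (y : ℕ → ℝ) :
    lin (tfDT N P) (N + P + 2) n y
      = if n = 0 then y 0 - y 1 / 3 else y (n - 1) / (2 * (n : ℝ) - 1) - y (n + 1) / (2 * (n : ℝ) + 3) := by
  unfold lin
  have hent : ∀ j < N + P + 2, (get2 (tfDT N P) n j : ℝ) = ((intEntry n j : ℚ) : ℝ) := by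
    intro j hj; rw [get2_tfDT, if_pos ⟨hn, hj⟩]
  by_cases h0 : n = 0
  · subst h0
    rw [if_pos rfl, sum_two_points _ 0 1 (by omega) (by omega) (by omega)]
    · rw [hent 0 (by omega), hent 1 (by omega)]; unfold intEntry; push_cast; simp; ring
    · intro j hj h1 h2; rw [hent j hj]; unfold intEntry; simp [h1, h2]
  · rw [if_neg h0, sum_two_points _ (n - 1) (n + 1) (by omega) (by omega) (by omega)]
    · rw [hent (n - 1) (by omega), hent (n + 1) (by omega)]; unfold intEntry
      have e1 : n - 1 + 1 = n := by omega
      have e2 : ¬ n - 1 = n + 1 := by omega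
      have e3 : ¬ (n + 1) + 1 = n := by omega
      simp only [h0, e1, e2, e3, if_true, if_false]
      push_cast; ring
    · intro j hj h1 h2; rw [hent j hj]; unfold intEntry
      have e2 : ¬ j + 1 = n := by omega
      simp [h0, e2, h2]

/-- **`lin tfD1 n c = a_n`** (`n < N+P+2`) for the ladder `c → a` with the wall relation. -/
theorem lin_tfD1_eq_ladder {N P : ℕ} {c a : ℕ → ℝ} (hA : IsLadder c a) (h0 : a 0 = c 0 - c 1 / 3) (n : ℕ) (hn : n < N + P + 2) :
    lin (tfD1 N P) (N + P + 3) n c = a n := by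
  rw [lin_tfD1 N P n hn]
  rcases n with _ | m
  · simp [h0]
  · rw [if_neg (by omega), hA m, show m + 1 - 1 = m from rfl, show m + 1 + 1 = m + 2 from rfl]
    push_cast
    rw [show (2 * ((m : ℝ) + 1) - 1) = 2 * (m : ℝ) + 1 by ring, show (2 * ((m : ℝ) + 1) + 3) = 2 * (m : ℝ) + 5 by ring]

/-- **`lin tfDT n d = e_n`** (`n < N+P+1`) for the ladder `d → e` with the wall relation. -/
theorem lin_tfDT_eq_ladder {N P : ℕ} {d e : ℕ → ℝ} (hE : IsLadder d e) (h0 : e 0 = d 0 - d 1 / 3) (n : ℕ) (hn : n < N + P + 1) :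
    lin (tfDT N P) (N + P + 2) n d = e n := by
  rw [lin_tfDT N P n hn]
  rcases n with _ | m
  · simp [h0]
  · rw [if_neg (by omega), hE m, show m + 1 - 1 = m from rfl, show m + 1 + 1 = m + 2 from rfl]
    push_cast
    rw [show (2 * ((m : ℝ) + 1) - 1) = 2 * (m : ℝ) + 1 by ring, show (2 * ((m : ℝ) + 1) + 3) = 2 * (m : ℝ) + 5 by ring]

/-- `tfD0` rows through `tfD1`. -/
theorem lin_tfD0_sum (N P n : ℕ) (hn : n < N + P + 1) (x : ℕ → ℝ) :
    lin (tfD0 N P) (N + P + 3) n x = ∑ i ∈ range (N + P + 2), ((intEntry n i : ℚ) : ℝ) * lin (tfD1 N P) (N + P + 3) i x := by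
  unfold lin
  have hent : ∀ j, (get2 (tfD0 N P) n j : ℝ) = ∑ i ∈ range (N + P + 2), ((intEntry n i : ℚ) : ℝ) * (get2 (tfD1 N P) i j : ℝ) := by
    intro j; rw [get2_tfD0, if_pos hn]; push_cast; rfl
  simp_rw [hent, Finset.sum_mul]
  rw [Finset.sum_comm]
  refine Finset.sum_congr rfl fun i _ => ?_
  rw [Finset.mul_sum]
  exact Finset.sum_congr rfl fun j _ => by ring

/-- `tfD0` rows written out in terms of `tfD1`. -/
theorem lin_tfD0 (N P n : ℕ) (hn : n < N + P + 1) (x : ℕ → ℝ) :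
    lin (tfD0 N P) (N + P + 3) n x
      = if n = 0 then lin (tfD1 N P) (N + P + 3) 0 x - lin (tfD1 N P) (N + P + 3) 1 x / 3
        else lin (tfD1 N P) (N + P + 3) (n - 1) x / (2 * (n : ℝ) - 1) - lin (tfD1 N P) (N + P + 3) (n + 1) x / (2 * (n : ℝ) + 3) := by
  rw [lin_tfD0_sum N P n hn]
  by_cases h0 : n = 0
  · subst h0
    rw [if_pos rfl, sum_two_points _ 0 1 (by omega) (by omega) (by omega)]
    · unfold intEntry; push_cast; simp; ring
    · intro j _ h1 h2; unfold intEntry; simp [h1, h2]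
  · rw [if_neg h0, sum_two_points _ (n - 1) (n + 1) (by omega) (by omega) (by omega)]
    · unfold intEntry
      have e1 : n - 1 + 1 = n := by omega
      have e2 : ¬ n - 1 = n + 1 := by omega
      have e3 : ¬ (n + 1) + 1 = n := by omega
      simp only [h0, e1, e2, e3, if_true, if_false]
      push_cast; ring
    · intro j _ h1 h2; unfold intEntry
      have e2 : ¬ j + 1 = n := by omega
      simp [h0, e2, h2]

/-- **`lin tfD0 n c = b_n`** (`n < N+P+1`) for the double ladder `c → a → b` with both wall relations. -/
theorem lin_tfD0_eq_ladder {N P : ℕ} {c a b : ℕ → ℝ} (hA : IsLadder c a) (h0a : a 0 = c 0 - c 1 / 3)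
    (hB : IsLadder a b) (h0b : b 0 = a 0 - a 1 / 3) (n : ℕ) (hn : n < N + P + 1) :
    lin (tfD0 N P) (N + P + 3) n c = b n := by
  rw [lin_tfD0 N P n hn]
  rcases n with _ | m
  · rw [if_pos rfl, lin_tfD1_eq_ladder hA h0a 0 (by omega), lin_tfD1_eq_ladder hA h0a 1 (by omega), h0b]
  · rw [if_neg (by omega), show m + 1 - 1 = m from rfl, show m + 1 + 1 = m + 2 from rfl,
      lin_tfD1_eq_ladder hA h0a m (by omega), lin_tfD1_eq_ladder hA h0a (m + 2) (by omega), hB m]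
    push_cast
    rw [show (2 * ((m : ℝ) + 1) - 1) = 2 * (m : ℝ) + 1 by ring, show (2 * ((m : ℝ) + 1) + 3) = 2 * (m : ℝ) + 5 by ring]

/-! ### Parseval splits -/

/-- **W part** (SPEC 3.5): for `W : ℝ[X]` with `W(−1) = W_x(−1) = 0`, `LW = N+P+3 ≤ L`, `deg W < L`, and `c, a, b` the Legendre coefficients of `W_xx, W_x, W`:
`16·KINV2·∫W_xx² + 8∫W_x² + K2∫W² = cᵀ·XW·c + 16·KINV2·Σ_{k<L−LW} w c² (from LW) + 8·Σ w a² (from LW−1) + K2·Σ w b² (from LW−2)`. -/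
theorem normsW_split (N P : ℕ) (KINV2 K2 : ℚ) (W : ℝ[X]) (hW : W.eval (-1) = 0) (hW' : (derivative W).eval (-1) = 0)
    (L : ℕ) (hL : N + P + 3 ≤ L) (hdeg : W.natDegree < L) :
    16 * (KINV2 : ℝ) * (∫ x in (-1 : ℝ)..1, (derivative (derivative W)).eval x ^ 2)
      + 8 * (∫ x in (-1 : ℝ)..1, (derivative W).eval x ^ 2)
      + (K2 : ℝ) * (∫ x in (-1 : ℝ)..1, W.eval x ^ 2)
    = qform (xwTab N P KINV2 K2) (N + P + 3) (legCoeff (derivative (derivative W)))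
      + (16 * (KINV2 : ℝ) * ∑ k ∈ range (L - (N + P + 3)), w (N + P + 3 + k) * legCoeff (derivative (derivative W)) (N + P + 3 + k) ^ 2
        + 8 * ∑ k ∈ range (L - (N + P + 2)), w (N + P + 2 + k) * legCoeff (derivative W) (N + P + 2 + k) ^ 2
        + (K2 : ℝ) * ∑ k ∈ range (L - (N + P + 1)), w (N + P + 1 + k) * legCoeff W (N + P + 1 + k) ^ 2) := by
  have hd1 : (derivative W).natDegree < L := lt_of_le_of_lt ((natDegree_derivative_le W).trans (Nat.sub_le _ _)) hdeg
  have hd2 : (derivative (derivative W)).natDegree < L :=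
    lt_of_le_of_lt ((natDegree_derivative_le _).trans (Nat.sub_le _ _)) hd1
  rw [parseval_split _ hd2 hL, parseval_split _ hd1 (show N + P + 2 ≤ L by omega), parseval_split _ hdeg (show N + P + 1 ≤ L by omega)]
  set c := legCoeff (derivative (derivative W))
  set a := legCoeff (derivative W)
  set b := legCoeff W
  have hA : IsLadder c a := isLadder_legCoeff (derivative W) hW'
  have h0a : a 0 = c 0 - c 1 / 3 := legCoeff_zero_of_wall (derivative W) hW'
  have hB : IsLadder a b := isLadder_legCoeff W hW
  have h0b : b 0 = a 0 - a 1 / 3 := legCoeff_zero_of_wall W hW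
  rw [qform_xwTab]
  have e0 : ∑ j ∈ range (N + P + 3), (norm2 j : ℝ) * c j ^ 2 = ∑ j ∈ range (N + P + 3), w j * c j ^ 2 :=
    Finset.sum_congr rfl fun j _ => by rw [norm2_cast]
  have e1 : ∑ n ∈ range (N + P + 2), (norm2 n : ℝ) * lin (tfD1 N P) (N + P + 3) n c ^ 2 = ∑ n ∈ range (N + P + 2), w n * a n ^ 2 :=
    Finset.sum_congr rfl fun n hn => by rw [norm2_cast, lin_tfD1_eq_ladder hA h0a n (by simpa using hn)]
  have e2 : ∑ n ∈ range (N + P + 1), (norm2 n : ℝ) * lin (tfD0 N P) (N + P + 3) n c ^ 2 = ∑ n ∈ range (N + P + 1), w n * b n ^ 2 :=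
    Finset.sum_congr rfl fun n hn => by rw [norm2_cast, lin_tfD0_eq_ladder hA h0a hB h0b n (by simpa using hn)]
  rw [e0, e1, e2]
  ring

/-- **Θ part** (SPEC 3.5): for `Θ : ℝ[X]` with `Θ(−1) = 0`, `LT = N+P+2 ≤ L`, `deg Θ < L`, and `d, e` the Legendre coefficients of `Θ_x, Θ`:
`4∫Θ_x² + K2∫Θ² = dᵀ·XT·d + 4·Σ w d² (from LT) + K2·Σ w e² (from LT−1)`. -/
theorem normsT_split (N P : ℕ) (K2 : ℚ) (Θ : ℝ[X]) (hΘ : Θ.eval (-1) = 0) (L : ℕ) (hL : N + P + 2 ≤ L) (hdeg : Θ.natDegree < L) :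
    4 * (∫ x in (-1 : ℝ)..1, (derivative Θ).eval x ^ 2) + (K2 : ℝ) * (∫ x in (-1 : ℝ)..1, Θ.eval x ^ 2)
    = qform (xtTab N P K2) (N + P + 2) (legCoeff (derivative Θ))
      + (4 * ∑ k ∈ range (L - (N + P + 2)), w (N + P + 2 + k) * legCoeff (derivative Θ) (N + P + 2 + k) ^ 2
        + (K2 : ℝ) * ∑ k ∈ range (L - (N + P + 1)), w (N + P + 1 + k) * legCoeff Θ (N + P + 1 + k) ^ 2) := by
  have hd1 : (derivative Θ).natDegree < L := lt_of_le_of_lt ((natDegree_derivative_le Θ).trans (Nat.sub_le _ _)) hdeg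
  rw [parseval_split _ hd1 hL, parseval_split _ hdeg (show N + P + 1 ≤ L by omega)]
  set d := legCoeff (derivative Θ)
  set e := legCoeff Θ
  have hE : IsLadder d e := isLadder_legCoeff Θ hΘ
  have h0 : e 0 = d 0 - d 1 / 3 := legCoeff_zero_of_wall Θ hΘ
  rw [qform_xtTab]
  have e0 : ∑ j ∈ range (N + P + 2), (norm2 j : ℝ) * d j ^ 2 = ∑ j ∈ range (N + P + 2), w j * d j ^ 2 :=
    Finset.sum_congr rfl fun j _ => by rw [norm2_cast]
  have e1 : ∑ n ∈ range (N + P + 1), (norm2 n : ℝ) * lin (tfDT N P) (N + P + 2) n d ^ 2 = ∑ n ∈ range (N + P + 1), w n * e n ^ 2 :=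
    Finset.sum_congr rfl fun n hn => by rw [norm2_cast, lin_tfDT_eq_ladder hE h0 n (by simpa using hn)]
  rw [e0, e1]
  ring

end Summit.NavierStokesRegularity.TurbBounds.ShearSpecPiecesTF

end
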